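import Summits.SmoothPoincare4.SmoothPoincare4.Theses.CongruenceShadows
import Summits.SmoothPoincare4.SmoothPoincare4.Theorems.WaldhausenPairs.Negative.LoadBearing

/-!
# Level collapse and the genus-3 private conjunct — line `pair-rigidity-retraction` for crux
`CongruenceShadows.HeegaardHandlebodyCongruenceClosed` (item stmt-SmoothPoincare4-14596, route
route-SmoothPoincare4-CongruenceShadows; `--supports` the crux)

Sorry-free dividends of the lead's reshaped skeleton `Cruxes/HeegaardHandlebodyCongruenceClosed/Lines/pair-rigidity-retraction.lean`
(r1), stated in importable vocabulary only (no local definitions).  Notation in the docstrings: `S = S_{3+3m} =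
SurfaceGroup (3+3m)`, `N = (N₀,N₁,N₂) = s4Kernels.stabilizeIter m`, `A∩B = Stab N₀ ∩ Stab N₁`, `C = Stab N₂` (in `Aut S`),
`T_ρ = (N₀, N₁, ρN₂)`, `G_ρ = S ⧸ (N₀ ⊔ N₁ ⊔ ρN₂)`; "`ρ` is product-congruent" = the crux hypothesis (`ρ ≡ x ∘ c` modulo
every characteristic finite-index `M`, `x ∈ A∩B`, `c ∈ C`).

* `tripleShadow_of_productCongruent` — a product-congruent `ρ` has all characteristic finite shadows of `T_ρ` standard.
* `tripleJoin_sup_eq_top_of_productCongruent` — level collapse: `(N₀ ⊔ N₁ ⊔ ρN₂) ⊔ M = ⊤` at every characteristic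
  finite-index level (`Ĝ_ρ = 1`); `hom_trivial_of_productCongruent` — the same in Hom form.
* `exists_characteristic_le` — characteristic finite-index subgroups are cofinal in the surface group.
* `limitsSimplyConnected_zero` (= registered stub P3₀ `stub_limitsSimplyConnectedZero`) — the line's private conjunct P3 ("limits are simply connected") is a THEOREM at genus 3:
  `N₀ ⊔ N₁ ⊔ ρN₂ = ⊤` for every product-congruent `ρ ∈ Aut S₃` (cyclic collapse: `G_ρ` is a quotient of
  `S₃ ⧸ (N₀ ⊔ N₁) = ⟨b̄₀⟩ ≅ ℤ`).
-/

noncomputable section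

-- the prescribed namespace `Summit.<P>.<Sub>.…` duplicates `SmoothPoincare4` (P = Sub)
set_option linter.dupNamespace false

namespace Summit.SmoothPoincare4.SmoothPoincare4.Theorems.HeegaardHandlebodyCongruenceClosed.PairRigidityRetraction

open Literature.Topology.FourManifolds Subgroup
open Summit.SmoothPoincare4.SmoothPoincare4.Theorems.WaldhausenPairs.Negative (stabilizeIter_isGroupTrisection)
/-! ## Elementary lemmas on the standard triple -/

/-- The standard kernels `N_i` are normal. [folklore] -/
theorem stabilizeIter_normal (m : ℕ) (i : Fin 3) : (s4Kernels.stabilizeIter m i).Normal :=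
  (stabilizeIter_isGroupTrisection m).normal i

/-- Images of the standard kernels under automorphisms are normal. [folklore] -/
theorem map_stabilizeIter_normal (m : ℕ) (i : Fin 3)
    (ρ : SurfaceGroup (3 + 3 * m) ≃* SurfaceGroup (3 + 3 * m)) :
    ((s4Kernels.stabilizeIter m i).map ρ.toMonoidHom).Normal :=
  Subgroup.Normal.map (stabilizeIter_normal m i) _ ρ.surjective

/-- The standard kernels normally generate `S` (the triple quotient of `N` is trivial). [folklore] -/
theorem normalClosure_stabilizeIter_eq_top (m : ℕ) :
    normalClosure (⋃ i, (s4Kernels.stabilizeIter m i : Set (SurfaceGroup (3 + 3 * m)))) = ⊤ := by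
  obtain ⟨e⟩ := (stabilizeIter_isGroupTrisection m).triple
  haveI : Subsingleton (TrisectionKernels.tripleQuotient (s4Kernels.stabilizeIter m)) := e.toEquiv.subsingleton
  exact QuotientGroup.subgroup_eq_top_of_subsingleton _ inferInstance

/-- `N₀ ⊔ N₁ ⊔ N₂ = ⊤`. [folklore] -/
theorem sup_stabilizeIter_eq_top (m : ℕ) :
    s4Kernels.stabilizeIter m 0 ⊔ s4Kernels.stabilizeIter m 1 ⊔ s4Kernels.stabilizeIter m 2 = ⊤ := by
  haveI h0n : (s4Kernels.stabilizeIter m 0).Normal := stabilizeIter_normal m 0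
  haveI h1n : (s4Kernels.stabilizeIter m 1).Normal := stabilizeIter_normal m 1
  haveI h2n : (s4Kernels.stabilizeIter m 2).Normal := stabilizeIter_normal m 2
  haveI h01n : (s4Kernels.stabilizeIter m 0 ⊔ s4Kernels.stabilizeIter m 1).Normal := Subgroup.sup_normal _ _
  haveI : (s4Kernels.stabilizeIter m 0 ⊔ s4Kernels.stabilizeIter m 1 ⊔ s4Kernels.stabilizeIter m 2).Normal :=
    Subgroup.sup_normal _ _
  rw [eq_top_iff, ← normalClosure_stabilizeIter_eq_top m]
  refine normalClosure_le_normal (Set.iUnion_subset fun i => ?_)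
  fin_cases i
  · exact fun s hs => mem_sup_left (mem_sup_left hs)
  · exact fun s hs => mem_sup_left (mem_sup_right hs)
  · exact fun s hs => mem_sup_right hs

/-- A characteristic subgroup is carried to itself by every automorphism. [folklore] -/
theorem map_eq_of_characteristic {G : Type*} [Group G] (x : G ≃* G) {M : Subgroup G} (hM : M.Characteristic) :
    M.map x.toMonoidHom = M :=
  (Subgroup.characteristic_iff_map_eq.mp hM) x

/-- Pointwise congruence `ρ ≡ x ∘ c (mod M)` moves images of subgroups only within `M`. [folklore] -/
theorem map_sup_eq_of_congr {G : Type*} [Group G] {ρ x c : G ≃* G} {M : Subgroup G}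
    (h : ∀ s, ρ s * (x (c s))⁻¹ ∈ M) (H : Subgroup G) :
    H.map ρ.toMonoidHom ⊔ M = (H.map c.toMonoidHom).map x.toMonoidHom ⊔ M := by
  apply le_antisymm
  · refine sup_le ?_ le_sup_right
    rintro _ ⟨s, hs, rfl⟩
    have : ρ s = (ρ s * (x (c s))⁻¹) * x (c s) := by group
    rw [MulEquiv.coe_toMonoidHom, this]
    exact mul_mem (mem_sup_right (h s)) (mem_sup_left ⟨c s, ⟨s, hs, rfl⟩, rfl⟩)
  · refine sup_le ?_ le_sup_right
    rintro _ ⟨_, ⟨s, hs, rfl⟩, rfl⟩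
    have : x (c s) = (ρ s * (x (c s))⁻¹)⁻¹ * ρ s := by group
    rw [MulEquiv.coe_toMonoidHom, MulEquiv.coe_toMonoidHom, this]
    exact mul_mem (mem_sup_right (inv_mem (h s))) (mem_sup_left ⟨s, hs, rfl⟩)

/-! ## What product-congruence hands over: standard shadows and level collapse -/

/-- **Standard shadows.** A product-congruent `ρ` has all three characteristic finite shadows of
`T_ρ = (N₀, N₁, ρN₂)` standard simultaneously (witness `ψ_M := x_M`): the shadow hypothesis of
`ShadowApproximation` for `K = T_ρ`. [folklore] -/
theorem tripleShadow_of_productCongruent {m : ℕ} {ρ : SurfaceGroup (3 + 3 * m) ≃* SurfaceGroup (3 + 3 * m)}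
    (h : ∀ M : Subgroup (SurfaceGroup (3 + 3 * m)), M.Characteristic → M.FiniteIndex →
      ∃ x c : SurfaceGroup (3 + 3 * m) ≃* SurfaceGroup (3 + 3 * m),
        (s4Kernels.stabilizeIter m 0).map x.toMonoidHom = s4Kernels.stabilizeIter m 0 ∧
        (s4Kernels.stabilizeIter m 1).map x.toMonoidHom = s4Kernels.stabilizeIter m 1 ∧
        (s4Kernels.stabilizeIter m 2).map c.toMonoidHom = s4Kernels.stabilizeIter m 2 ∧
        ∀ s, ρ s * (x (c s))⁻¹ ∈ M) :
    ∀ M : Subgroup (SurfaceGroup (3 + 3 * m)), M.Characteristic → M.FiniteIndex →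
      ∃ ψ : SurfaceGroup (3 + 3 * m) ≃* SurfaceGroup (3 + 3 * m), ∀ i : Fin 3,
        (s4Kernels.stabilizeIter m i ⊔ M).map ψ.toMonoidHom =
          (![s4Kernels.stabilizeIter m 0, s4Kernels.stabilizeIter m 1,
            (s4Kernels.stabilizeIter m 2).map ρ.toMonoidHom] : TrisectionKernels (3 + 3 * m)) i ⊔ M := by
  intro M hM hF
  obtain ⟨x, c, hx0, hx1, hc, hs⟩ := h M hM hF
  refine ⟨x, fun i => ?_⟩
  fin_cases i
  · show (s4Kernels.stabilizeIter m 0 ⊔ M).map x.toMonoidHom = s4Kernels.stabilizeIter m 0 ⊔ M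
    rw [Subgroup.map_sup, map_eq_of_characteristic x hM, hx0]
  · show (s4Kernels.stabilizeIter m 1 ⊔ M).map x.toMonoidHom = s4Kernels.stabilizeIter m 1 ⊔ M
    rw [Subgroup.map_sup, map_eq_of_characteristic x hM, hx1]
  · show (s4Kernels.stabilizeIter m 2 ⊔ M).map x.toMonoidHom = (s4Kernels.stabilizeIter m 2).map ρ.toMonoidHom ⊔ M
    rw [Subgroup.map_sup, map_eq_of_characteristic x hM, map_sup_eq_of_congr hs (s4Kernels.stabilizeIter m 2), hc]

/-- **Level collapse.** For a product-congruent `ρ`, `(N₀ ⊔ N₁ ⊔ ρN₂) ⊔ M = ⊤` at every characteristic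
finite-index level `M`: the glued group `G_ρ` is profinitely trivial. [folklore] -/
theorem tripleJoin_sup_eq_top_of_productCongruent {m : ℕ}
    {ρ : SurfaceGroup (3 + 3 * m) ≃* SurfaceGroup (3 + 3 * m)}
    (h : ∀ M : Subgroup (SurfaceGroup (3 + 3 * m)), M.Characteristic → M.FiniteIndex →
      ∃ x c : SurfaceGroup (3 + 3 * m) ≃* SurfaceGroup (3 + 3 * m),
        (s4Kernels.stabilizeIter m 0).map x.toMonoidHom = s4Kernels.stabilizeIter m 0 ∧
        (s4Kernels.stabilizeIter m 1).map x.toMonoidHom = s4Kernels.stabilizeIter m 1 ∧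
        (s4Kernels.stabilizeIter m 2).map c.toMonoidHom = s4Kernels.stabilizeIter m 2 ∧
        ∀ s, ρ s * (x (c s))⁻¹ ∈ M)
    (M : Subgroup (SurfaceGroup (3 + 3 * m))) (hM : M.Characteristic) (hF : M.FiniteIndex) :
    (s4Kernels.stabilizeIter m 0 ⊔ s4Kernels.stabilizeIter m 1 ⊔ (s4Kernels.stabilizeIter m 2).map ρ.toMonoidHom) ⊔ M
      = ⊤ := by
  obtain ⟨x, c, h0, h1, h2, hs⟩ := h M hM hF
  haveI := hM
  haveI : M.Normal := inferInstance
  haveI h0n : (s4Kernels.stabilizeIter m 0).Normal := stabilizeIter_normal m 0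
  haveI h1n : (s4Kernels.stabilizeIter m 1).Normal := stabilizeIter_normal m 1
  haveI h2n : ((s4Kernels.stabilizeIter m 2).map ρ.toMonoidHom).Normal := map_stabilizeIter_normal m 2 ρ
  haveI h01n : (s4Kernels.stabilizeIter m 0 ⊔ s4Kernels.stabilizeIter m 1).Normal := Subgroup.sup_normal _ _
  haveI h012n : (s4Kernels.stabilizeIter m 0 ⊔ s4Kernels.stabilizeIter m 1 ⊔
      (s4Kernels.stabilizeIter m 2).map ρ.toMonoidHom).Normal := Subgroup.sup_normal _ _
  haveI : (s4Kernels.stabilizeIter m 0 ⊔ s4Kernels.stabilizeIter m 1 ⊔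
      (s4Kernels.stabilizeIter m 2).map ρ.toMonoidHom ⊔ M).Normal := Subgroup.sup_normal _ _
  have hx : Function.Surjective x.toMonoidHom := x.surjective
  have e2 : (s4Kernels.stabilizeIter m 2).map ρ.toMonoidHom ⊔ M = (s4Kernels.stabilizeIter m 2).map x.toMonoidHom ⊔ M := by
    rw [map_sup_eq_of_congr hs, h2]
  have key : (⊤ : Subgroup (SurfaceGroup (3 + 3 * m))).map x.toMonoidHom ≤
      (s4Kernels.stabilizeIter m 0 ⊔ s4Kernels.stabilizeIter m 1 ⊔ (s4Kernels.stabilizeIter m 2).map ρ.toMonoidHom) ⊔ M := by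
    rw [← normalClosure_stabilizeIter_eq_top m, map_normalClosure _ _ hx]
    refine normalClosure_le_normal ?_
    rintro _ ⟨s, hs', rfl⟩
    simp only [Set.mem_iUnion, SetLike.mem_coe] at hs'
    obtain ⟨i, hi⟩ := hs'
    fin_cases i
    · exact mem_sup_left (mem_sup_left (mem_sup_left (h0.le ⟨s, hi, rfl⟩)))
    · exact mem_sup_left (mem_sup_left (mem_sup_right (h1.le ⟨s, hi, rfl⟩)))
    · have : x.toMonoidHom s ∈ (s4Kernels.stabilizeIter m 2).map ρ.toMonoidHom ⊔ M := by
        rw [e2]; exact mem_sup_left ⟨s, hi, rfl⟩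
      exact (sup_le_sup_right le_sup_right M) this
  rw [eq_top_iff]
  refine le_trans ?_ key
  rw [← MonoidHom.range_eq_map, MonoidHom.range_eq_top.2 hx]

/-! ## Cofinality of characteristic finite-index subgroups; profinite triviality of `G_ρ` in Hom form -/

/-- Homomorphisms from the surface group to a finite group form a finite set (determined on the generators).
[folklore] -/
theorem finite_hom_surfaceGroup (g : ℕ) (Q : Type) [Group Q] [Finite Q] : Finite (SurfaceGroup g →* Q) :=
  Finite.of_injective
    (fun f : SurfaceGroup g →* Q => fun p : surfaceGen g => f (PresentedGroup.of p))
    (fun _ _ h => PresentedGroup.ext fun p => congrFun h p)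

/-- The characteristic core `⨅_{f : S_g →* Q} ker f` is characteristic. [folklore] -/
theorem iInf_ker_characteristic (g : ℕ) (Q : Type) [Group Q] :
    (⨅ f : SurfaceGroup g →* Q, f.ker).Characteristic := by
  refine Subgroup.characteristic_iff_le_comap.2 fun φ s hs => ?_
  rw [Subgroup.mem_comap]
  simp only [Subgroup.mem_iInf, MonoidHom.mem_ker] at hs ⊢
  intro f
  exact hs (f.comp φ.toMonoidHom)

/-- … and of finite index when `Q` is finite. [folklore] -/
theorem iInf_ker_finiteIndex (g : ℕ) (Q : Type) [Group Q] [Finite Q] :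
    (⨅ f : SurfaceGroup g →* Q, f.ker).FiniteIndex :=
  haveI := finite_hom_surfaceGroup g Q
  Subgroup.finiteIndex_iInf fun _ => inferInstance

/-- **Cofinality.** Every finite-index subgroup of the surface group `S_g` contains a characteristic
finite-index subgroup (the characteristic core at the finite group `S_g ⧸ core H`). [folklore] -/
theorem exists_characteristic_le {g : ℕ} (H : Subgroup (SurfaceGroup g)) [H.FiniteIndex] :
    ∃ M : Subgroup (SurfaceGroup g), M.Characteristic ∧ M.FiniteIndex ∧ M ≤ H := by
  refine ⟨⨅ f : SurfaceGroup g →* SurfaceGroup g ⧸ H.normalCore, f.ker, iInf_ker_characteristic g _,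
    iInf_ker_finiteIndex g _, ?_⟩
  calc (⨅ f : SurfaceGroup g →* SurfaceGroup g ⧸ H.normalCore, f.ker)
      ≤ (QuotientGroup.mk' H.normalCore).ker := iInf_le (fun f : SurfaceGroup g →* _ => f.ker) _
    _ = H.normalCore := QuotientGroup.ker_mk' _
    _ ≤ H := Subgroup.normalCore_le H

/-- **`Ĝ_ρ = 1` in Hom form.** For a product-congruent `ρ`, every homomorphism from `S` to a finite group
that kills `N₀ ⊔ N₁ ⊔ ρN₂` is trivial. [folklore] -/
theorem hom_trivial_of_productCongruent {m : ℕ} {ρ : SurfaceGroup (3 + 3 * m) ≃* SurfaceGroup (3 + 3 * m)}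
    (h : ∀ M : Subgroup (SurfaceGroup (3 + 3 * m)), M.Characteristic → M.FiniteIndex →
      ∃ x c : SurfaceGroup (3 + 3 * m) ≃* SurfaceGroup (3 + 3 * m),
        (s4Kernels.stabilizeIter m 0).map x.toMonoidHom = s4Kernels.stabilizeIter m 0 ∧
        (s4Kernels.stabilizeIter m 1).map x.toMonoidHom = s4Kernels.stabilizeIter m 1 ∧
        (s4Kernels.stabilizeIter m 2).map c.toMonoidHom = s4Kernels.stabilizeIter m 2 ∧
        ∀ s, ρ s * (x (c s))⁻¹ ∈ M)
    {Q : Type} [Group Q] [Finite Q] (f : SurfaceGroup (3 + 3 * m) →* Q)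
    (hf : s4Kernels.stabilizeIter m 0 ⊔ s4Kernels.stabilizeIter m 1 ⊔ (s4Kernels.stabilizeIter m 2).map ρ.toMonoidHom
      ≤ f.ker) (s : SurfaceGroup (3 + 3 * m)) : f s = 1 := by
  obtain ⟨M, hM, hF, hle⟩ := exists_characteristic_le f.ker
  have htop := tripleJoin_sup_eq_top_of_productCongruent h M hM hF
  have hs : s ∈ (s4Kernels.stabilizeIter m 0 ⊔ s4Kernels.stabilizeIter m 1 ⊔
      (s4Kernels.stabilizeIter m 2).map ρ.toMonoidHom) ⊔ M := by
    rw [htop]; exact Subgroup.mem_top s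
  exact (sup_le hf hle) hs

/-! ## The private conjunct at genus 3: limits are simply connected (cyclic collapse) -/

/-- At genus 3 every generator other than `b₀` lies in `N₀ ⊔ N₁` (`N₀ = ⟪a₀,a₁,b₂⟫`, `N₁ = ⟪a₀,b₁,a₂⟫`). [folklore] -/
theorem of_mem_sup_s4Kernels (p : surfaceGen 3) (hp : p ≠ (0, true)) :
    (PresentedGroup.of p : SurfaceGroup 3) ∈ s4Kernels 0 ⊔ s4Kernels 1 := by
  obtain ⟨i, bit⟩ := p
  fin_cases i <;> cases bit
  · exact mem_sup_left (of_mem_s4Kernels 0 (by decide))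
  · exact absurd rfl hp
  · exact mem_sup_left (of_mem_s4Kernels 0 (by decide))
  · exact mem_sup_right (of_mem_s4Kernels 1 (by decide))
  · exact mem_sup_right (of_mem_s4Kernels 1 (by decide))
  · exact mem_sup_left (of_mem_s4Kernels 0 (by decide))

/-- **Limits are simply connected at genus 3.** For every product-congruent `ρ ∈ Aut S₃`,
`N₀ ⊔ N₁ ⊔ ρN₂ = ⊤`: the glued group `G_ρ` is a quotient of `S₃ ⧸ (N₀ ⊔ N₁) = ⟨b̄₀⟩`, hence cyclic, and a
non-trivial cyclic group has a non-trivial finite quotient `ℤ/p`, which `hom_trivial_of_productCongruent` forbids.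
(The `m = 0` case of the line's stub P3 `LimitsSimplyConnected`.) [folklore] -/
theorem limitsSimplyConnected_zero (ρ : SurfaceGroup (3 + 3 * 0) ≃* SurfaceGroup (3 + 3 * 0))
    (h : ∀ M : Subgroup (SurfaceGroup (3 + 3 * 0)), M.Characteristic → M.FiniteIndex →
      ∃ x c : SurfaceGroup (3 + 3 * 0) ≃* SurfaceGroup (3 + 3 * 0),
        (s4Kernels.stabilizeIter 0 0).map x.toMonoidHom = s4Kernels.stabilizeIter 0 0 ∧
        (s4Kernels.stabilizeIter 0 1).map x.toMonoidHom = s4Kernels.stabilizeIter 0 1 ∧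
        (s4Kernels.stabilizeIter 0 2).map c.toMonoidHom = s4Kernels.stabilizeIter 0 2 ∧
        ∀ s, ρ s * (x (c s))⁻¹ ∈ M) :
    s4Kernels.stabilizeIter 0 0 ⊔ s4Kernels.stabilizeIter 0 1 ⊔ (s4Kernels.stabilizeIter 0 2).map ρ.toMonoidHom = ⊤ := by
  -- notation: `T = N₀ ⊔ N₁ ⊔ ρN₂ ≤ S₃`
  change s4Kernels 0 ⊔ s4Kernels 1 ⊔ (s4Kernels 2).map ρ.toMonoidHom = ⊤
  set T : Subgroup (SurfaceGroup 3) := s4Kernels 0 ⊔ s4Kernels 1 ⊔ (s4Kernels 2).map ρ.toMonoidHom with hT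
  haveI h0n : (s4Kernels 0).Normal := stabilizeIter_normal 0 0
  haveI h1n : (s4Kernels 1).Normal := stabilizeIter_normal 0 1
  haveI h2n : ((s4Kernels 2).map ρ.toMonoidHom).Normal := map_stabilizeIter_normal 0 2 ρ
  haveI : (s4Kernels 0 ⊔ s4Kernels 1 : Subgroup (SurfaceGroup 3)).Normal := Subgroup.sup_normal _ _
  haveI hTn : T.Normal := Subgroup.sup_normal _ _
  -- `S₃ ⧸ T` is cyclic, generated by the class of `b₀`
  have hgen : Subgroup.zpowers ((QuotientGroup.mk (SurfaceGroup.b 0 : SurfaceGroup 3)) : SurfaceGroup 3 ⧸ T) = ⊤ := by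
    rw [eq_top_iff, ← Subgroup.map_top_of_surjective _ (QuotientGroup.mk'_surjective T),
      ← PresentedGroup.closure_range_of, MonoidHom.map_closure, Subgroup.closure_le]
    rintro _ ⟨_, ⟨p, rfl⟩, rfl⟩
    by_cases hp : p = (0, true)
    · subst hp
      exact Subgroup.mem_zpowers _
    · rw [SetLike.mem_coe, QuotientGroup.mk'_apply,
        (QuotientGroup.eq_one_iff _).2 (show (PresentedGroup.of p : SurfaceGroup 3) ∈ T from
          mem_sup_left (of_mem_sup_s4Kernels p hp))]
      exact one_mem _
  by_contra hne
  have hcyc : IsCyclic (SurfaceGroup 3 ⧸ T) := isCyclic_iff_exists_zpowers_eq_top.2 ⟨_, hgen⟩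
  haveI hnt : Nontrivial (SurfaceGroup 3 ⧸ T) := by
    by_contra hc
    rw [not_nontrivial_iff_subsingleton] at hc
    exact hne (QuotientGroup.subgroup_eq_top_of_subsingleton _ hc)
  have hcard : Nat.card (SurfaceGroup 3 ⧸ T) ≠ 1 := fun hc =>
    not_subsingleton _ (Nat.card_eq_one_iff_unique.1 hc).1
  obtain ⟨p, hp, hpd⟩ := Nat.exists_prime_and_dvd hcard
  haveI : Fact p.Prime := ⟨hp⟩
  let e : Multiplicative (ZMod (Nat.card (SurfaceGroup 3 ⧸ T))) ≃* SurfaceGroup 3 ⧸ T := zmodCyclicMulEquiv hcyc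
  let r : Multiplicative (ZMod (Nat.card (SurfaceGroup 3 ⧸ T))) →* Multiplicative (ZMod p) :=
    AddMonoidHom.toMultiplicative (ZMod.castHom hpd (ZMod p)).toAddMonoidHom
  let f : SurfaceGroup 3 →* Multiplicative (ZMod p) := r.comp (e.symm.toMonoidHom.comp (QuotientGroup.mk' T))
  have hr : Function.Surjective r := fun y => by
    obtain ⟨x, hx⟩ := ZMod.ringHom_surjective (ZMod.castHom hpd (ZMod p)) y.toAdd
    exact ⟨Multiplicative.ofAdd x, by simp [r, hx]⟩
  have hf : Function.Surjective f := hr.comp (e.symm.surjective.comp (QuotientGroup.mk'_surjective _))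
  have hker : T ≤ f.ker := by
    intro s hs
    rw [MonoidHom.mem_ker]
    simp [f, (QuotientGroup.eq_one_iff s).2 hs]
  obtain ⟨s, hs⟩ := hf (Multiplicative.ofAdd 1)
  have h1 : f s = 1 := hom_trivial_of_productCongruent (m := 0) h f hker s
  rw [hs] at h1
  simp at h1

/-- **Registered stub P3₀ of line `pair-rigidity-retraction`** (signature verbatim as registered on
stmt-SmoothPoincare4-14596): limits are simply connected at genus 3, `= limitsSimplyConnected_zero`. [folklore] -/
theorem stub_limitsSimplyConnectedZero : ∀ (ρ : Literature.Topology.FourManifolds.SurfaceGroup (3 + 3 * 0) ≃* Literature.Topology.FourManifolds.SurfaceGroup (3 + 3 * 0)), (∀ M : Subgroup (Literature.Topology.FourManifolds.SurfaceGroup (3 + 3 * 0)), M.Characteristic → M.FiniteIndex → ∃ x c : Literature.Topology.FourManifolds.SurfaceGroup (3 + 3 * 0) ≃* Literature.Topology.FourManifolds.SurfaceGroup (3 + 3 * 0), (Literature.Topology.FourManifolds.s4Kernels.stabilizeIter 0 0).map x.toMonoidHom = Literature.Topology.FourManifolds.s4Kernels.stabilizeIter 0 0 ∧ (Literature.Topology.FourManifolds.s4Kernels.stabilizeIter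 0 1).map x.toMonoidHom = Literature.Topology.FourManifolds.s4Kernels.stabilizeIter 0 1 ∧ (Literature.Topology.FourManifolds.s4Kernels.stabilizeIter 0 2).map c.toMonoidHom = Literature.Topology.FourManifolds.s4Kernels.stabilizeIter 0 2 ∧ ∀ s, ρ s * (x (c s))⁻¹ ∈ M) → Literature.Topology.FourManifolds.s4Kernels.stabilizeIter 0 0 ⊔ Literature.Topology.FourManifolds.s4Kernels.stabilizeIter 0 1 ⊔ (Literature.Topology.FourManifolds.s4Kernels.stabilizeIter 0 2).map ρ.toMonoidHom = ⊤ :=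
  fun ρ h => limitsSimplyConnected_zero ρ h

end Summit.SmoothPoincare4.SmoothPoincare4.Theorems.HeegaardHandlebodyCongruenceClosed.PairRigidityRetraction

end
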